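import Summits.AtomisticToContinuum.HydrodynamicLimit.Theorems.RelayRaceLocalityNearConstantShortTimeHLVelDomination
import Summits.AtomisticToContinuum.HydrodynamicLimit.Theorems.RelayRaceLocalityNearConstantShortTimeHLVelAux
import Summits.AtomisticToContinuum.HydrodynamicLimit.Theorems.RelayRaceLocalityNearConstantShortTimeHLChessboard
import Summits.AtomisticToContinuum.HydrodynamicLimit.Theorems.RelayRaceLocalityNearConstantShortTimeHLPerBall
import Summits.AtomisticToContinuum.HydrodynamicLimit.Theorems.RelayRaceLocalityNearConstantShortTimeHLLinearKinetic
import Summits.AtomisticToContinuum.HydrodynamicLimit.Theorems.RelayRaceLocalityNearConstantShortTimeHLSt2SplitDefs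
import HarnessLib

/-!
# Crux `NearConstantShortTimeHL` (stmt-AtomisticToContinuum-12502), line `small-tilt-domination` — registered skeleton stub
`stub_velocityLD : BallGaussianEstimate → VelocityMesoscaleLD` (St2′-V of skeleton v10)

THE CONDITIONAL GAUSSIAN CHESSBOARD ESTIMATE. Given the positions `x` of `m` particles, the velocities are independent Gaussians
`vᵢ ∼ N(u₁(xᵢ), θ₁(xᵢ) I₃)` (`velMeasure`). For the energy-weighted capped mesoscale deviation `fluctuationE` at radius `ℓ = m^{-1/4}`:
`∫ exp(γ m · fluctuationE) d velMeasure ≤ exp(κ m + γ' m · splitFunctional R)` eventually in `m`, uniformly over boxed profiles and ALL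
position configurations, with `splitFunctional = smoothedDeviation + crowding R` charging the positions. Assembly of the landed pieces:

1. pointwise domination `fluctuationE ≤ 2(1+c_M) smoothedDeviation + ∫ chessIntegrand + 2 m⁻¹ Σᵢ wᵢ (Yᵢ)₊` (`fluctuationE_zipConfig_le`);
2. Cauchy–Schwarz between the chessboard factor `exp(γ m ∫ chessIntegrand)` and the linear factor `exp(2γ Σ wᵢ (Yᵢ)₊)`;
3. the linear factor: `∫ exp(4γ Σ wᵢ(Yᵢ)₊) ≤ exp(4Bγ Σ wᵢ) ≤ exp(4Bγ m smoothedDeviation)` (`lintegral_exp_linear_kinetic_le`,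
   `sum_linWeight_le`, clause (ii) of the ball Gaussian estimate);
4. the chessboard factor: mesh `k` even with `2ℓ ≤ 1/k ≤ 4ℓ` (`exists_even_mesh`), per-centre bound `lintegral_exp_chessIntegrand_le`
   (normal balls by clause (i) of the ball Gaussian estimate, crowded balls — more than `R'ν` particles, `ν = m · 4/3πℓ³` — charged to the
   crowded particles, `ball_subset_crowded`), then `chessboard_lintegral_exp_le`: `≤ (B^{k³} exp(27 C #crowded))^{1/8}`;
5. bookkeeping: `k³ ≤ mℓ/8` makes `k³ log B = o(m)`, `#crowded = m · crowding`, and the choice `γ = min(γ₀/(256 C_W), γ'/D)`.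

References: H.-T. Yau, Lett. Math. Phys. 22 (1991) §2.
-/

noncomputable section

namespace Summit.AtomisticToContinuum.HydrodynamicLimit.Theorems.NearConstantShortTimeHL

open scoped BigOperators ENNReal
open MeasureTheory Set Filter Topology ProbabilityTheory
open Literature.MathematicalPhysics.KineticTheory Literature.Analysis.FluidPDE Literature.Analysis.FunctionSpaces

/-! ## The assembly -/

/-- **Registered skeleton stub `stub_velocityLD`** (St2′-V of skeleton v10 of the line `small-tilt-domination`): the
conditional Gaussian chessboard estimate `VelocityMesoscaleLD` from the ball Gaussian estimate. [cite: Yau1991, §2] -/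
theorem stub_velocityLD : BallGaussianEstimate → VelocityMesoscaleLD := by
  intro hBall M hM ρM R γ' hγ'
  -- constants
  have hM0 : 0 ≤ M := zero_le_one.trans hM
  set c : ℝ := M ^ 2 / 2 + 3 / 2 * M with hc_def
  have hc : 0 ≤ c := by positivity
  set R' : ℝ := max R 1 with hR'_def
  have hR'1 : 1 ≤ R' := le_max_right _ _
  have hR'0 : 0 < R' := one_pos.trans_le hR'1
  have hRR' : R ≤ R' := le_max_left _ _
  obtain ⟨γ₀, hγ₀, B, hBi, hBii⟩ := hBall M hM R' hR'0
  set B₁ : ℝ := max B 1 with hB₁_def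
  have hB₁1 : 1 ≤ B₁ := le_max_right _ _
  have hBB₁ : B ≤ B₁ := le_max_left _ _
  have hB₁0 : 0 < B₁ := one_pos.trans_le hB₁1
  -- (i) and (ii) with `B₁`
  have hBi' : ∀ ν : ℝ, 1 ≤ ν → ∀ k : ℕ, (k : ℝ) ≤ R' * ν → ∀ (u : Fin k → V3) (θ : Fin k → ℝ),
      (∀ i, M⁻¹ ≤ θ i ∧ θ i ≤ M ∧ ‖u i‖ ≤ M) →
      ∫⁻ v, ENNReal.ofReal (Real.exp (γ₀ * (min ν (‖∑ i, (v i - u i)‖ ^ 2 / ν) +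
        min ν ((∑ i, (‖v i‖ ^ 2 / 2 - ‖u i‖ ^ 2 / 2 - 3 / 2 * θ i)) ^ 2 / ν) +
        (if ν < ∑ i, (‖v i‖ ^ 2 / 2 - ‖u i‖ ^ 2 / 2 - 3 / 2 * θ i)
          then ∑ i, (‖v i‖ ^ 2 / 2 - ‖u i‖ ^ 2 / 2 - 3 / 2 * θ i) else 0))))
        ∂(Measure.pi fun i => gaussMeasure (u i) (θ i)) ≤ ENNReal.ofReal B₁ :=
    fun ν hν k hk u θ hbox => (hBi ν hν k hk u θ hbox).trans (ENNReal.ofReal_le_ofReal hBB₁)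
  have hBii' : ∀ s : ℝ, 0 ≤ s → s ≤ γ₀ → ∀ (u : V3) (θ : ℝ), M⁻¹ ≤ θ → θ ≤ M → ‖u‖ ≤ M →
      ∫⁻ v, ENNReal.ofReal (Real.exp (s * max 0 (‖v‖ ^ 2 / 2 - ‖u‖ ^ 2 / 2 - 3 / 2 * θ))) ∂(gaussMeasure u θ) ≤
        ENNReal.ofReal (Real.exp (B₁ * s)) :=
    fun s hs hsγ u θ h1 h2 h3 => (hBii s hs hsγ u θ h1 h2 h3).trans
      (ENNReal.ofReal_le_ofReal (Real.exp_le_exp.2 (mul_le_mul_of_nonneg_right hBB₁ hs)))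
  set CW : ℝ := 2 + 2 * (1 + (1 + c) * R') with hCW_def
  have hCW4 : 4 ≤ CW := by
    have h : 0 ≤ (1 + c) * R' := by positivity
    linarith only [h, hCW_def]
  set K₁ : ℝ := 4 / R' + 2 * (1 + c) + 2 * B₁ with hK₁_def
  have hK₁0 : 0 ≤ K₁ := by positivity
  set D : ℝ := 2 * (1 + c) + 2 * B₁ + 432 * K₁ + 1 with hD_def
  have hD0 : 0 < D := by positivity
  set γ : ℝ := min (γ₀ / (256 * CW)) (γ' / D) with hγ_def
  have hγ0 : 0 < γ := lt_min (by positivity) (by positivity)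
  have hγ1 : 256 * γ * CW ≤ γ₀ := by
    have : γ ≤ γ₀ / (256 * CW) := min_le_left _ _
    rw [le_div_iff₀ (by positivity)] at this; linarith
  have hγ2 : γ * D ≤ γ' := by
    have : γ ≤ γ' / D := min_le_right _ _
    rwa [le_div_iff₀ hD0] at this
  have hγ4 : 4 * γ ≤ γ₀ := by
    have h := mul_le_mul_of_nonneg_left hCW4 hγ0.le
    have h' : 0 ≤ γ * CW := by positivity
    linarith only [h, h', hγ1]
  refine ⟨γ, hγ0, fun κ hκ => ?_⟩
  -- eventually in `m`
  have hℓtend : Tendsto (fun m : ℕ => mesoRadius m) atTop (𝓝 0) :=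
    (tendsto_rpow_neg_atTop (by norm_num : (0 : ℝ) < 1 / 4)).comp tendsto_natCast_atTop_atTop
  have hev : ∀ᶠ m : ℕ in atTop, 0 < m ∧ mesoRadius m ≤ 1 / 8 ∧ Real.log B₁ * mesoRadius m ≤ 128 * κ := by
    have h1 : ∀ᶠ m : ℕ in atTop, 0 < m := eventually_gt_atTop 0
    have h2 : ∀ᶠ m : ℕ in atTop, mesoRadius m ≤ 1 / 8 := hℓtend.eventually (eventually_le_nhds (by norm_num))
    have h3 : ∀ᶠ m : ℕ in atTop, Real.log B₁ * mesoRadius m ≤ 128 * κ := by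
      have : Tendsto (fun m : ℕ => Real.log B₁ * mesoRadius m) atTop (𝓝 (Real.log B₁ * 0)) := hℓtend.const_mul _
      rw [mul_zero] at this
      exact this.eventually (eventually_le_nhds (by positivity))
    filter_upwards [h1, h2, h3] with m a b d using ⟨a, b, d⟩
  filter_upwards [hev] with m hm
  obtain ⟨hm0, hℓ8, hℓκ⟩ := hm
  intro ρ₁ θ₁ u₁ hρc hθc huc _hρ1 hbox _hlip x
  -- the scales
  have hm0' : (0 : ℝ) < m := Nat.cast_pos.2 hm0
  have hℓ0m : 0 < mesoRadius m := Real.rpow_pos_of_pos hm0' _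
  have hℓ4m : mesoRadius m ^ 4 = ((m : ℝ))⁻¹ := by
    unfold mesoRadius
    rw [← Real.rpow_natCast, ← Real.rpow_mul hm0'.le]
    norm_num
    exact Real.rpow_neg_one _
  obtain ⟨ℓ, hℓ_def⟩ : ∃ ℓ : ℝ, mesoRadius m = ℓ := ⟨_, rfl⟩
  rw [hℓ_def] at hℓ8 hℓκ hℓ0m hℓ4m
  simp only [hℓ_def]
  have hℓ0 : 0 < ℓ := hℓ0m
  have hℓ4 : ℓ ^ 4 = ((m : ℝ))⁻¹ := hℓ4m
  have hℓhalf : ℓ < 1 / 2 := by linarith only [hℓ8]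
  have hmℓ4 : (m : ℝ) * ℓ ^ 4 = 1 := by rw [hℓ4, mul_inv_cancel₀ hm0'.ne']
  have hmℓ3 : (m : ℝ) * ℓ ^ 3 = ℓ⁻¹ :=
    eq_inv_of_mul_eq_one_left (by rw [mul_assoc, ← pow_succ]; exact hmℓ4)
  set V : ℝ := 4 / 3 * Real.pi * ℓ ^ 3 with hV_def
  have hV0 : 0 < V := by positivity
  set ν : ℝ := (m : ℝ) * V with hν_def
  have hπ3 : (3 : ℝ) < Real.pi := Real.pi_gt_three
  have hν1 : 1 ≤ ν := by
    have h8 : 8 ≤ ℓ⁻¹ := by rw [le_inv_comm₀ (by norm_num) hℓ0]; linarith only [hℓ8]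
    have e : ν = (4 / 3 * Real.pi) * ((m : ℝ) * ℓ ^ 3) := by rw [hν_def, hV_def]; ring
    rw [e, hmℓ3]
    exact one_le_mul_of_one_le_of_one_le (by linarith only [hπ3]) (by linarith only [h8])
  -- the mesh
  obtain ⟨k, hk, hke, hk1, hk2⟩ := exists_even_mesh hℓ0 hℓ8
  have hkpos : (0 : ℝ) < k := Nat.cast_pos.2 hk
  have hk3 : ((k : ℝ) ^ 3)⁻¹ ≤ 64 * ℓ ^ 3 := by
    rw [← inv_pow]
    calc ((k : ℝ)⁻¹) ^ 3 ≤ (4 * ℓ) ^ 3 := pow_le_pow_left₀ (inv_nonneg.2 hkpos.le) hk2 3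
      _ = 64 * ℓ ^ 3 := by ring
  have hk3' : (k : ℝ) ^ 3 ≤ (m : ℝ) * ℓ / 8 := by
    -- `k ≤ 1/(2ℓ)` so `k³ ≤ (2ℓ)⁻³ = m ℓ / 8`
    have h1 : (k : ℝ) ≤ (2 * ℓ)⁻¹ := (le_inv_comm₀ hkpos (mul_pos two_pos hℓ0)).2 hk1
    have h2 : (k : ℝ) ^ 3 ≤ ((2 * ℓ)⁻¹) ^ 3 := pow_le_pow_left₀ hkpos.le h1 3
    have h3 : ((2 * ℓ)⁻¹) ^ 3 = (m : ℝ) * ℓ / 8 := by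
      have : (m : ℝ) = (ℓ ^ 4)⁻¹ := by rw [hℓ4, inv_inv]
      rw [this]; field_simp; ring
    linarith [h3 ▸ h2]
  -- the per-ball exponent
  set γ₁ : ℝ := 16 * γ / ((k : ℝ) ^ 3 * V) with hγ₁_def
  have hγ₁0 : 0 ≤ γ₁ := by positivity
  have hγ₁le : γ₁ ≤ 256 * γ := by
    rw [hγ₁_def, div_le_iff₀ (by positivity)]
    have : (16 : ℝ) * γ = 16 * γ * (((k : ℝ) ^ 3)⁻¹ * (k : ℝ) ^ 3) := by rw [inv_mul_cancel₀ (by positivity)]; ring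
    rw [this]
    have hV64 : ((k : ℝ) ^ 3)⁻¹ ≤ 16 * V := by
      have hℓ3 : 0 ≤ ℓ ^ 3 := (pow_pos hℓ0 3).le
      calc ((k : ℝ) ^ 3)⁻¹ ≤ 64 * ℓ ^ 3 := hk3
        _ = (64 / 3) * 3 * ℓ ^ 3 := by ring
        _ ≤ (64 / 3) * Real.pi * ℓ ^ 3 :=
            mul_le_mul_of_nonneg_right (mul_le_mul_of_nonneg_left hπ3.le (by norm_num)) hℓ3
        _ = 16 * V := by rw [hV_def]; ring
    calc 16 * γ * (((k : ℝ) ^ 3)⁻¹ * (k : ℝ) ^ 3) = (16 * γ * (k : ℝ) ^ 3) * ((k : ℝ) ^ 3)⁻¹ := by ring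
      _ ≤ (16 * γ * (k : ℝ) ^ 3) * (16 * V) := mul_le_mul_of_nonneg_left hV64 (by positivity)
      _ = 256 * γ * ((k : ℝ) ^ 3 * V) := by ring
  have hγ₁CW : γ₁ * (2 + 2 * (1 + (1 + (M ^ 2 / 2 + 3 / 2 * M)) * R')) ≤ γ₀ := by
    rw [← hc_def, ← hCW_def]
    calc γ₁ * CW ≤ 256 * γ * CW := mul_le_mul_of_nonneg_right hγ₁le (by linarith)
      _ ≤ γ₀ := hγ1
  have hsν : γ₁ * ν = 16 * γ * m / (k : ℝ) ^ 3 := by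
    rw [hγ₁_def, hν_def]; field_simp
  have hbox' : ∀ y, M⁻¹ ≤ θ₁ y ∧ θ₁ y ≤ M ∧ ‖u₁ y‖ ≤ M := fun y => ⟨(hbox y).2.2.1, (hbox y).2.2.2.1, (hbox y).2.2.2.2⟩
  -- the crowded set
  set T : Finset (Fin m) := Finset.univ.filter fun i => R * ((m : ℝ) * ℓ ^ 3) < (nearCount (12 * ℓ) (x i) x : ℝ)
    with hT_def
  have hcrowdT : crowding R ℓ x = (m : ℝ)⁻¹ * T.card := rfl
  -- per-centre bound
  set Ccr : ℝ := γ₁ * K₁ with hCcr_def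
  have hCcr0 : 0 ≤ Ccr := by positivity
  have hper : ∀ y, ∫⁻ v, ENNReal.ofReal (Real.exp ((γ₁ * ν) * chessIntegrand M ℓ θ₁ u₁ x v y)) ∂velMeasure u₁ θ₁ x ≤
      ENNReal.ofReal (B₁ * Real.exp (Ccr * ((T.filter fun i => Torus.euclidDist y (x i) < ℓ).card : ℝ))) := by
    intro y
    have h := lintegral_exp_chessIntegrand_le hM hR'1 hγ₀ hB₁1 hBi' hBii' hℓ0 hℓhalf hν1 hbox' hγ₁0 hγ₁CW x y
    refine h.trans (ENNReal.ofReal_le_ofReal (mul_le_mul_of_nonneg_left (Real.exp_le_exp.2 ?_) hB₁0.le))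
    rw [show (4 / R' + 2 * (1 + c) + 2 * B₁) = K₁ from hK₁_def.symm, ← hCcr_def]
    refine mul_le_mul_of_nonneg_left ?_ hCcr0
    split_ifs with hcr
    · refine Nat.cast_le.2 (Finset.card_le_card fun i hi => ?_)
      rw [Finset.mem_filter] at hi ⊢
      refine ⟨?_, hi.2⟩
      rw [hT_def, Finset.mem_filter]
      exact ⟨Finset.mem_univ _, ball_subset_crowded hℓ0 hRR' hR'0.le x y hcr hi.2⟩
    · exact Nat.cast_nonneg _
  -- the chessboard estimate for `g y v = chessIntegrand … v y`
  have hchess : ∫⁻ v, ENNReal.ofReal (Real.exp (2 * γ * m * ∫ y, chessIntegrand M ℓ θ₁ u₁ x v y)) ∂velMeasure u₁ θ₁ x ≤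
      ENNReal.ofReal ((B₁ ^ (k ^ 3) * Real.exp (27 * Ccr * T.card)) ^ (1 / 8 : ℝ)) := by
    have h := chessboard_lintegral_exp_le (fun i => gaussMeasure (u₁ (x i)) (θ₁ (x i))) hk hke hk1 x
      (fun y v => chessIntegrand M ℓ θ₁ u₁ x v y) (fun y v => chessIntegrand_nonneg M ℓ hM0 θ₁ u₁ x v y)
      (measurable_chessIntegrand_uncurry M ℓ θ₁ u₁ x) (fun v => exists_chessIntegrand_le hM0 ℓ θ₁ u₁ x v)
      (fun y v w hvw => chessIntegrand_congr_of_ball M ℓ θ₁ u₁ x hvw) (mul_nonneg hγ₁0 (by positivity : (0:ℝ) ≤ ν))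
      hB₁1 hCcr0 T hper
    have e : γ₁ * ν * (k : ℝ) ^ 3 / 8 = 2 * γ * m := by
      rw [hsν]; field_simp; ring
    rw [e] at h
    exact h
  -- the linear term
  have hlin : ∫⁻ v, ENNReal.ofReal (Real.exp ((4 * γ) * ∑ i, linWeight ℓ ρ₁ θ₁ u₁ x i *
      max 0 (‖v i‖ ^ 2 / 2 - ‖u₁ (x i)‖ ^ 2 / 2 - 3 / 2 * θ₁ (x i)))) ∂velMeasure u₁ θ₁ x ≤
      ENNReal.ofReal (Real.exp (4 * B₁ * γ * m * smoothedDeviation ℓ ρ₁ θ₁ u₁ x)) := by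
    have h := lintegral_exp_linear_kinetic_le hBii' hbox' x (fun i => linWeight ℓ ρ₁ θ₁ u₁ x i)
      (fun i => ⟨linWeight_nonneg ℓ ρ₁ θ₁ u₁ x i, linWeight_le_one hℓ0 hℓhalf ρ₁ θ₁ u₁ x i⟩)
      (by positivity : 0 ≤ 4 * γ) hγ4
    refine h.trans (ENNReal.ofReal_le_ofReal (Real.exp_le_exp.2 ?_))
    have hs := sum_linWeight_le (ℓ := ℓ) hρc.measurable hθc.measurable huc.measurable x
    calc B₁ * (4 * γ) * ∑ i, linWeight ℓ ρ₁ θ₁ u₁ x i ≤ B₁ * (4 * γ) * (m * smoothedDeviation ℓ ρ₁ θ₁ u₁ x) :=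
          mul_le_mul_of_nonneg_left hs (by positivity)
      _ = 4 * B₁ * γ * m * smoothedDeviation ℓ ρ₁ θ₁ u₁ x := by ring
  -- abbreviations for the assembly
  set sD : ℝ := smoothedDeviation ℓ ρ₁ θ₁ u₁ x with hsD_def
  have hsD0 : 0 ≤ sD := by
    rw [hsD_def, smoothedDeviation_eq]
    exact integral_nonneg fun y => mul_nonneg (by
      have : 0 ≤ ballDens ℓ x y := mul_nonneg (inv_nonneg.2 (Nat.cast_nonneg m))
        (Finset.sum_nonneg fun i _ => ballKernel_nonneg ℓ y (x i))
      linarith) (le_min zero_le_one (by unfold posDev; positivity))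
  have hsplitF : splitFunctional R ℓ ρ₁ θ₁ u₁ x = sD + (m : ℝ)⁻¹ * T.card := by
    rw [hsD_def]; rfl
  set f : (Fin m → V3) → ℝ≥0∞ := fun v =>
    ENNReal.ofReal (Real.exp (2 * γ * m * ∫ y, chessIntegrand M ℓ θ₁ u₁ x v y)) with hf_def
  set g : (Fin m → V3) → ℝ≥0∞ := fun v => ENNReal.ofReal (Real.exp ((4 * γ) * ∑ i, linWeight ℓ ρ₁ θ₁ u₁ x i *
      max 0 (‖v i‖ ^ 2 / 2 - ‖u₁ (x i)‖ ^ 2 / 2 - 3 / 2 * θ₁ (x i)))) with hg_def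
  set a₁ : ℝ := 2 * (1 + c) * γ * m * sD with ha₁_def
  -- measurability of `f` and `g`
  have hfm : AEMeasurable f (velMeasure u₁ θ₁ x) := by
    have h1 : Measurable fun v : Fin m → V3 => ∫ y, chessIntegrand M ℓ θ₁ u₁ x v y := by
      have h := (measurable_chessIntegrand_uncurry M ℓ θ₁ u₁ x).comp measurable_swap
      exact ((h.stronglyMeasurable).integral_prod_right' (ν := (volume : Measure T3))).measurable
    exact ((h1.const_mul _).exp.ennreal_ofReal).aemeasurable
  have hgm : AEMeasurable g (velMeasure u₁ θ₁ x) := by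
    have h1 : Measurable fun v : Fin m → V3 => ∑ i, linWeight ℓ ρ₁ θ₁ u₁ x i *
        max 0 (‖v i‖ ^ 2 / 2 - ‖u₁ (x i)‖ ^ 2 / 2 - 3 / 2 * θ₁ (x i)) :=
      Finset.measurable_sum _ fun i _ => measurable_const.mul (measurable_const.max
        (((((measurable_pi_apply i).norm.pow_const 2).div_const 2).sub_const _).sub_const _))
    exact ((h1.const_mul _).exp.ennreal_ofReal).aemeasurable
  -- pointwise domination of the integrand
  have hpt : ∀ v, ENNReal.ofReal (Real.exp (γ * (m : ℝ) * fluctuationE ℓ ρ₁ θ₁ u₁ (zipConfig (x, v)))) ≤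
      ENNReal.ofReal (Real.exp a₁) * (f v ^ (1 / 2 : ℝ) * g v ^ (1 / 2 : ℝ)) := by
    intro v
    have hdom := fluctuationE_zipConfig_le hℓ0 hℓhalf hM0 hρc.measurable hθc.measurable huc.measurable
      (fun y => (hbox y).2.2.2.1) (fun y => (hbox y).2.2.2.2) x v
    rw [← smoothedDeviation_eq, ← hc_def] at hdom
    have hf2 : f v ^ (1 / 2 : ℝ) = ENNReal.ofReal (Real.exp (γ * m * ∫ y, chessIntegrand M ℓ θ₁ u₁ x v y)) := by
      rw [hf_def]
      dsimp only
      rw [ENNReal.ofReal_rpow_of_nonneg (Real.exp_pos _).le (by norm_num), ← Real.exp_mul]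
      congr 1; ring_nf
    have hg2 : g v ^ (1 / 2 : ℝ) = ENNReal.ofReal (Real.exp ((2 * γ) * ∑ i, linWeight ℓ ρ₁ θ₁ u₁ x i *
        max 0 (‖v i‖ ^ 2 / 2 - ‖u₁ (x i)‖ ^ 2 / 2 - 3 / 2 * θ₁ (x i)))) := by
      rw [hg_def]
      dsimp only
      rw [ENNReal.ofReal_rpow_of_nonneg (Real.exp_pos _).le (by norm_num), ← Real.exp_mul]
      congr 1; ring_nf
    rw [hf2, hg2, ← ENNReal.ofReal_mul (Real.exp_pos _).le, ← ENNReal.ofReal_mul (Real.exp_pos _).le,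
      ← Real.exp_add, ← Real.exp_add]
    refine ENNReal.ofReal_le_ofReal (Real.exp_le_exp.2 ?_)
    have hγm : 0 ≤ γ * (m : ℝ) := by positivity
    have h := mul_le_mul_of_nonneg_left hdom hγm
    have e : γ * (m : ℝ) * (2 * ((m : ℝ)⁻¹ * ∑ i, linWeight ℓ ρ₁ θ₁ u₁ x i *
        max 0 (‖v i‖ ^ 2 / 2 - ‖u₁ (x i)‖ ^ 2 / 2 - 3 / 2 * θ₁ (x i)))) =
        (2 * γ) * ∑ i, linWeight ℓ ρ₁ θ₁ u₁ x i * max 0 (‖v i‖ ^ 2 / 2 - ‖u₁ (x i)‖ ^ 2 / 2 - 3 / 2 * θ₁ (x i)) := by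
      field_simp
    have e2 : γ * (m : ℝ) * (2 * (1 + c) * smoothedDeviation ℓ ρ₁ θ₁ u₁ x + (∫ y, chessIntegrand M ℓ θ₁ u₁ x v y) +
        2 * ((m : ℝ)⁻¹ * ∑ i, linWeight ℓ ρ₁ θ₁ u₁ x i * max 0 (‖v i‖ ^ 2 / 2 - ‖u₁ (x i)‖ ^ 2 / 2 - 3 / 2 * θ₁ (x i)))) =
        a₁ + γ * m * (∫ y, chessIntegrand M ℓ θ₁ u₁ x v y) +
        (2 * γ) * ∑ i, linWeight ℓ ρ₁ θ₁ u₁ x i * max 0 (‖v i‖ ^ 2 / 2 - ‖u₁ (x i)‖ ^ 2 / 2 - 3 / 2 * θ₁ (x i)) := by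
      rw [mul_add, mul_add, e, ha₁_def, hsD_def]; ring
    linarith only [h, e2]
  -- integrate, Cauchy–Schwarz
  have hCS : ∫⁻ v, f v ^ (1 / 2 : ℝ) * g v ^ (1 / 2 : ℝ) ∂velMeasure u₁ θ₁ x ≤
      (∫⁻ v, f v ∂velMeasure u₁ θ₁ x) ^ (1 / 2 : ℝ) * (∫⁻ v, g v ∂velMeasure u₁ θ₁ x) ^ (1 / 2 : ℝ) :=
    ENNReal.lintegral_mul_norm_pow_le hfm hgm (by norm_num) (by norm_num) (by norm_num)
  have hvel : velMeasure u₁ θ₁ x = Measure.pi fun i => gaussMeasure (u₁ (x i)) (θ₁ (x i)) := rfl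
  have hf_int : ∫⁻ v, f v ∂velMeasure u₁ θ₁ x ≤ ENNReal.ofReal ((B₁ ^ (k ^ 3) * Real.exp (27 * Ccr * T.card)) ^ (1 / 8 : ℝ)) :=
    hchess
  have hg_int : ∫⁻ v, g v ∂velMeasure u₁ θ₁ x ≤ ENNReal.ofReal (Real.exp (4 * B₁ * γ * m * sD)) := hlin
  -- the real-number bookkeeping
  have hE₀ : B₁ ^ (k ^ 3) * Real.exp (27 * Ccr * T.card) = Real.exp ((k : ℝ) ^ 3 * Real.log B₁ + 27 * Ccr * T.card) := by
    rw [Real.exp_add, ← Nat.cast_pow, Real.exp_nat_mul, Real.exp_log hB₁0]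
  have hTc : (m : ℝ) * ((m : ℝ)⁻¹ * T.card) = T.card := by field_simp
  have hkey : a₁ + ((k : ℝ) ^ 3 * Real.log B₁ + 27 * Ccr * T.card) / 16 + 2 * B₁ * γ * m * sD ≤
      κ * m + γ' * m * (sD + (m : ℝ)⁻¹ * T.card) := by
    have hlogB : 0 ≤ Real.log B₁ := Real.log_nonneg hB₁1
    -- the `sD` terms
    have h1 : (2 * (1 + c) + 2 * B₁) * γ ≤ γ' := by
      have hle : (2 * (1 + c) + 2 * B₁) ≤ D := by linarith only [hD_def, hK₁0]
      have hcomm : D * γ = γ * D := mul_comm D γ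
      linarith only [mul_le_mul_of_nonneg_right hle hγ0.le, hγ2, hcomm]
    have h1' : a₁ + 2 * B₁ * γ * m * sD ≤ γ' * m * sD := by
      have hmsD : 0 ≤ (m : ℝ) * sD := by positivity
      have e3 : a₁ + 2 * B₁ * γ * m * sD = (2 * (1 + c) + 2 * B₁) * γ * ((m : ℝ) * sD) := by rw [ha₁_def]; ring
      have e4 : γ' * m * sD = γ' * ((m : ℝ) * sD) := by ring
      linarith only [mul_le_mul_of_nonneg_right h1 hmsD, e3, e4]
    -- the `log B₁` term
    have h2 : (k : ℝ) ^ 3 * Real.log B₁ / 16 ≤ κ * m := by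
      calc (k : ℝ) ^ 3 * Real.log B₁ / 16 ≤ ((m : ℝ) * ℓ / 8) * Real.log B₁ / 16 := by
            gcongr
        _ = (m : ℝ) * (Real.log B₁ * ℓ) / 128 := by ring
        _ ≤ (m : ℝ) * (128 * κ) / 128 := by gcongr
        _ = κ * m := by ring
    -- the crowding term
    have h3 : 27 * Ccr * (T.card : ℝ) / 16 ≤ γ' * m * ((m : ℝ)⁻¹ * T.card) := by
      have eT : γ' * m * ((m : ℝ)⁻¹ * T.card) = γ' * T.card := by rw [mul_assoc, hTc]
      rw [eT]
      have hT0 : 0 ≤ (T.card : ℝ) := Nat.cast_nonneg _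
      have hcoef : 27 * Ccr / 16 ≤ γ' := by
        rw [hCcr_def]
        have h432 : 432 * K₁ ≤ D := by linarith only [hD_def, hc, hB₁1]
        calc 27 * (γ₁ * K₁) / 16 ≤ 27 * (256 * γ * K₁) / 16 := by gcongr
          _ = γ * (432 * K₁) := by ring
          _ ≤ γ * D := mul_le_mul_of_nonneg_left h432 hγ0.le
          _ ≤ γ' := hγ2
      have e5 : 27 * Ccr * (T.card : ℝ) / 16 = (27 * Ccr / 16) * T.card := by ring
      linarith only [mul_le_mul_of_nonneg_right hcoef hT0, e5]
    have e6 : γ' * m * (sD + (m : ℝ)⁻¹ * T.card) = γ' * m * sD + γ' * m * ((m : ℝ)⁻¹ * T.card) := mul_add _ _ _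
    have e7 : ((k : ℝ) ^ 3 * Real.log B₁ + 27 * Ccr * T.card) / 16 =
        (k : ℝ) ^ 3 * Real.log B₁ / 16 + 27 * Ccr * (T.card : ℝ) / 16 := by ring
    linarith only [h1', h2, h3, e6, e7]
  -- conclude
  calc ∫⁻ v, ENNReal.ofReal (Real.exp (γ * (m : ℝ) * fluctuationE ℓ ρ₁ θ₁ u₁ (zipConfig (x, v)))) ∂velMeasure u₁ θ₁ x
      ≤ ∫⁻ v, ENNReal.ofReal (Real.exp a₁) * (f v ^ (1 / 2 : ℝ) * g v ^ (1 / 2 : ℝ)) ∂velMeasure u₁ θ₁ x :=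
        lintegral_mono hpt
    _ = ENNReal.ofReal (Real.exp a₁) * ∫⁻ v, f v ^ (1 / 2 : ℝ) * g v ^ (1 / 2 : ℝ) ∂velMeasure u₁ θ₁ x :=
        lintegral_const_mul' _ _ ENNReal.ofReal_ne_top
    _ ≤ ENNReal.ofReal (Real.exp a₁) * ((ENNReal.ofReal ((B₁ ^ (k ^ 3) * Real.exp (27 * Ccr * T.card)) ^ (1 / 8 : ℝ))) ^ (1 / 2 : ℝ) *
          (ENNReal.ofReal (Real.exp (4 * B₁ * γ * m * sD))) ^ (1 / 2 : ℝ)) := by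
        gcongr
        exact hCS.trans (mul_le_mul' (ENNReal.rpow_le_rpow hf_int (by norm_num)) (ENNReal.rpow_le_rpow hg_int (by norm_num)))
    _ = ENNReal.ofReal (Real.exp (a₁ + ((k : ℝ) ^ 3 * Real.log B₁ + 27 * Ccr * T.card) / 16 + 2 * B₁ * γ * m * sD)) := by
        rw [hE₀, ← Real.exp_mul, ENNReal.ofReal_rpow_of_nonneg (Real.exp_pos _).le (by norm_num),
          ENNReal.ofReal_rpow_of_nonneg (Real.exp_pos _).le (by norm_num), ← Real.exp_mul, ← Real.exp_mul,
          ← ENNReal.ofReal_mul (Real.exp_pos _).le, ← ENNReal.ofReal_mul (Real.exp_pos _).le, ← Real.exp_add,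
          ← Real.exp_add]
        congr 2
        ring
    _ ≤ ENNReal.ofReal (Real.exp (κ * m + γ' * m * splitFunctional R ℓ ρ₁ θ₁ u₁ x)) := by
        rw [hsplitF]
        exact ENNReal.ofReal_le_ofReal (Real.exp_le_exp.2 hkey)

end Summit.AtomisticToContinuum.HydrodynamicLimit.Theorems.NearConstantShortTimeHL

end
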